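import Summits.ResolutionOfSingularities.ResolutionOfSingularities.Theorems.FrobeniusClosingPatchingRelPerfectConeDepthSmoothQuadricRung
import HarnessLib

/-!
# Crux `PatchingRelPerfect` (stmt-ResolutionOfSingularities-16161), chain W5.2 — RUNG «r-quadric-disc-ℓ» BY NAME: the quadrics
# `x₀x₁ + x₂² + b·x₂x₃ + a·x₃²` with `b² − 4a` a UNIT — split and NON-SPLIT nondegenerate quadrics at once, every depth

[OURS · L1 W5.2 · rung tool] Replaces the role of NO printed item; NOT a statement of the manuscript under review; fact-free,
any characteristic, any residue field, no completeness, no coefficient field.  AI-written (AI review is weaker than expert review).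

`S` regular local of dimension `4`, `x₀, …, x₃` a regular system of parameters, `a, b ∈ S` with the discriminant `b² − 4a` of
the binary form `N(u, v) = u² + b uv + a v²` a UNIT (in residue characteristic `2`: `b` a unit), `q = x₀x₁ + N(x₂, x₃)`.
THEN `(q) + 𝔪^{ℓ+2} ∈ 𝒞` for EVERY `ℓ`, with the blow-up-form core conclusion (`discQuadricRung_of_ringKrullDim`; core dress
`atomDimFourBlowupAt_discQuadric`), by `smoothQuadricRung_of_ringKrullDim` applied to the form
`Q = T₀T₁ + T₂² + b T₂T₃ + a T₃²`: its reduced chart polynomials are smooth — on the charts `T₀ = 1`, `T₁ = 1` a partial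
derivative is `1`; on the charts `T₂ = 1`, `T₃ = 1` the identities
`(∂₃F₂)² + 4ā·T₀·∂₀F₂ − 4ā·F₂ = b̄² − 4ā` and `(∂₂F₃)² + 4·T₀·∂₀F₃ − 4·F₃ = b̄² − 4ā` exhibit the unit `b̄² − 4ā` in
`(F_i, ∂F_i)`.  When `T² + b̄T + ā` is irreducible over `κ` this is the NON-SPLIT nondegenerate quadric `x₀x₁ + N(x₂,x₃)` (no
chart of its strict transform is a graph over `κ`; e.g. every finite residue field has such an `N`); when it splits, a linear
change of parameters recovers g4's «r-quadric-ℓ» `x₀x₁ + x₂x₃` — the present rung needs neither case distinction nor `κ` perfect.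

## References
* J. Kollár, *Lectures on Resolution of Singularities* (2007), 3.61, (3.111) Step 3. [Kollar2007]
* H. Matsumura, *Commutative Ring Theory*, CUP 1986, Thm. 30.3 (Jacobian criterion). [Matsumura1987]
* The Stacks Project, Tag 080A. [StacksProject]
-/

set_option linter.dupNamespace false

noncomputable section

open CategoryTheory CategoryTheory.Limits AlgebraicGeometry TopologicalSpace IsLocalRing
open Literature.AlgebraicGeometry.Resolution
open Scheme.IdealSheafData
open scoped Pointwise

namespace Summit.ResolutionOfSingularities.ResolutionOfSingularities.Theorems

universe u

namespace ConeDepth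

/-! ## The form `T₀T₁ + T₂² + b T₂T₃ + a T₃²` and its reduced chart polynomials -/

section DiscForm

variable {S : Type u} [CommRing S] (a b : S)

/-- `T₀T₁ + T₂² + b T₂T₃ + a T₃²` is a form of degree `2`. [folklore] -/
theorem isHomogeneous_discForm :
    (MvPolynomial.X 0 * MvPolynomial.X 1 + MvPolynomial.X 2 * MvPolynomial.X 2 +
      MvPolynomial.C b * (MvPolynomial.X 2 * MvPolynomial.X 3) +
      MvPolynomial.C a * (MvPolynomial.X 3 * MvPolynomial.X 3) : MvPolynomial (Fin 4) S).IsHomogeneous 2 := by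
  have hX : ∀ j : Fin 4, (MvPolynomial.X j : MvPolynomial (Fin 4) S).IsHomogeneous 1 := fun j =>
    MvPolynomial.isHomogeneous_X S j
  have hC : ∀ s : S, (MvPolynomial.C s : MvPolynomial (Fin 4) S).IsHomogeneous 0 := fun s =>
    MvPolynomial.isHomogeneous_C _ s
  have h1 : (MvPolynomial.X 0 * MvPolynomial.X 1 : MvPolynomial (Fin 4) S).IsHomogeneous 2 := (hX 0).mul (hX 1)
  have h2 : (MvPolynomial.X 2 * MvPolynomial.X 2 : MvPolynomial (Fin 4) S).IsHomogeneous 2 := (hX 2).mul (hX 2)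
  have h3 : (MvPolynomial.C b * (MvPolynomial.X 2 * MvPolynomial.X 3) : MvPolynomial (Fin 4) S).IsHomogeneous 2 := by
    simpa using (hC b).mul ((hX 2).mul (hX 3))
  have h4 : (MvPolynomial.C a * (MvPolynomial.X 3 * MvPolynomial.X 3) : MvPolynomial (Fin 4) S).IsHomogeneous 2 := by
    simpa using (hC a).mul ((hX 3).mul (hX 3))
  exact ((h1.add h2).add h3).add h4

/-- `Q(x) = x₀x₁ + x₂² + b x₂x₃ + a x₃²`. [folklore] -/
theorem eval_discForm (x : Fin 4 → S) :
    MvPolynomial.eval x (MvPolynomial.X 0 * MvPolynomial.X 1 + MvPolynomial.X 2 * MvPolynomial.X 2 +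
      MvPolynomial.C b * (MvPolynomial.X 2 * MvPolynomial.X 3) +
      MvPolynomial.C a * (MvPolynomial.X 3 * MvPolynomial.X 3)) =
      x 0 * x 1 + x 2 ^ 2 + b * x 2 * x 3 + a * x 3 ^ 2 := by
  simp only [map_add, map_mul, MvPolynomial.eval_X, MvPolynomial.eval_C]
  ring

variable [IsLocalRing S]

/-- `killVar_i i = 1`. [folklore] -/
theorem killVar_self (i : Fin 4) : killVar (R := S) i i = 1 := dif_pos rfl

/-- `killVar_i j = T_j` for `j ≠ i`. [folklore] -/
theorem killVar_of_ne (i j : Fin 4) (h : j ≠ i) : killVar (R := S) i j = MvPolynomial.X ⟨j, h⟩ := dif_neg h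

/-- The reduced chart polynomials of `T₀T₁ + T₂² + b T₂T₃ + a T₃²` in terms of `killVar`. [folklore] -/
theorem chartPoly_discForm (i : Fin 4) :
    chartPoly (MvPolynomial.X 0 * MvPolynomial.X 1 + MvPolynomial.X 2 * MvPolynomial.X 2 +
      MvPolynomial.C b * (MvPolynomial.X 2 * MvPolynomial.X 3) +
      MvPolynomial.C a * (MvPolynomial.X 3 * MvPolynomial.X 3)) i =
      killVar i 0 * killVar i 1 + killVar i 2 * killVar i 2 +
        MvPolynomial.C (residue S b) * (killVar i 2 * killVar i 3) +
        MvPolynomial.C (residue S a) * (killVar i 3 * killVar i 3) := by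
  simp only [chartPoly, map_add, map_mul, MvPolynomial.map_X, MvPolynomial.map_C, MvPolynomial.aeval_X,
    MvPolynomial.algHom_C, MvPolynomial.algebraMap_eq]

/-- From a Bézout identity `G = C(d)` with `d ≠ 0` in the ideal to `I = (1)`. [folklore] -/
theorem ideal_eq_top_of_mem_of_eq_C {σ : Type*} {K : Type u} [Field K] {I : Ideal (MvPolynomial σ K)} {G : MvPolynomial σ K}
    {d : K} (hG : G ∈ I) (hGd : G = MvPolynomial.C d) (hd : d ≠ 0) : I = ⊤ := by
  refine (Ideal.eq_top_iff_one _).mpr ?_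
  have h := I.mul_mem_left (MvPolynomial.C d⁻¹) hG
  rwa [hGd, ← map_mul, inv_mul_cancel₀ hd, map_one] at h

/-! ### The four smoothness certificates -/

/-- Chart `T₀ = 1`: `∂F₀/∂T₁ = 1`. [cite: Matsumura1987, Thm. 30.3] -/
theorem discForm_smooth_zero :
    Ideal.span (insert (chartPoly (MvPolynomial.X 0 * MvPolynomial.X 1 + MvPolynomial.X 2 * MvPolynomial.X 2 +
        MvPolynomial.C b * (MvPolynomial.X 2 * MvPolynomial.X 3) +
        MvPolynomial.C a * (MvPolynomial.X 3 * MvPolynomial.X 3)) 0)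
      (Set.range fun t => MvPolynomial.pderiv t (chartPoly (MvPolynomial.X 0 * MvPolynomial.X 1 +
        MvPolynomial.X 2 * MvPolynomial.X 2 + MvPolynomial.C b * (MvPolynomial.X 2 * MvPolynomial.X 3) +
        MvPolynomial.C a * (MvPolynomial.X 3 * MvPolynomial.X 3)) 0))) = ⊤ := by
  classical
  refine Ideal.eq_top_of_isUnit_mem _ (Ideal.subset_span (Set.mem_insert_of_mem _ (Set.mem_range_self ⟨1, by decide⟩))) ?_
  rw [chartPoly_discForm, killVar_self, killVar_of_ne 0 1 (by decide), killVar_of_ne 0 2 (by decide),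
    killVar_of_ne 0 3 (by decide)]
  have h : MvPolynomial.pderiv (⟨1, by decide⟩ : {j : Fin 4 // j ≠ 0})
      ((1 : MvPolynomial {j : Fin 4 // j ≠ 0} (ResidueField S)) * MvPolynomial.X ⟨1, by decide⟩ +
        MvPolynomial.X ⟨2, by decide⟩ * MvPolynomial.X ⟨2, by decide⟩ +
        MvPolynomial.C (residue S b) * (MvPolynomial.X ⟨2, by decide⟩ * MvPolynomial.X ⟨3, by decide⟩) +
        MvPolynomial.C (residue S a) * (MvPolynomial.X ⟨3, by decide⟩ * MvPolynomial.X ⟨3, by decide⟩)) = 1 := by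
    simp [MvPolynomial.pderiv_X]
  rw [h]
  exact isUnit_one

/-- Chart `T₁ = 1`: `∂F₁/∂T₀ = 1`. [cite: Matsumura1987, Thm. 30.3] -/
theorem discForm_smooth_one :
    Ideal.span (insert (chartPoly (MvPolynomial.X 0 * MvPolynomial.X 1 + MvPolynomial.X 2 * MvPolynomial.X 2 +
        MvPolynomial.C b * (MvPolynomial.X 2 * MvPolynomial.X 3) +
        MvPolynomial.C a * (MvPolynomial.X 3 * MvPolynomial.X 3)) 1)
      (Set.range fun t => MvPolynomial.pderiv t (chartPoly (MvPolynomial.X 0 * MvPolynomial.X 1 +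
        MvPolynomial.X 2 * MvPolynomial.X 2 + MvPolynomial.C b * (MvPolynomial.X 2 * MvPolynomial.X 3) +
        MvPolynomial.C a * (MvPolynomial.X 3 * MvPolynomial.X 3)) 1))) = ⊤ := by
  classical
  refine Ideal.eq_top_of_isUnit_mem _ (Ideal.subset_span (Set.mem_insert_of_mem _ (Set.mem_range_self ⟨0, by decide⟩))) ?_
  rw [chartPoly_discForm, killVar_self, killVar_of_ne 1 0 (by decide), killVar_of_ne 1 2 (by decide),
    killVar_of_ne 1 3 (by decide)]
  have h : MvPolynomial.pderiv (⟨0, by decide⟩ : {j : Fin 4 // j ≠ 1})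
      (MvPolynomial.X ⟨0, by decide⟩ * (1 : MvPolynomial {j : Fin 4 // j ≠ 1} (ResidueField S)) +
        MvPolynomial.X ⟨2, by decide⟩ * MvPolynomial.X ⟨2, by decide⟩ +
        MvPolynomial.C (residue S b) * (MvPolynomial.X ⟨2, by decide⟩ * MvPolynomial.X ⟨3, by decide⟩) +
        MvPolynomial.C (residue S a) * (MvPolynomial.X ⟨3, by decide⟩ * MvPolynomial.X ⟨3, by decide⟩)) = 1 := by
    simp [MvPolynomial.pderiv_X]
  rw [h]
  exact isUnit_one

/-- Chart `T₂ = 1`: `(∂₃F₂)² + 4ā·T₀·∂₀F₂ − 4ā·F₂ = b̄² − 4ā`. [cite: Matsumura1987, Thm. 30.3] -/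
theorem discForm_smooth_two (hD : IsUnit (b ^ 2 - 4 * a)) :
    Ideal.span (insert (chartPoly (MvPolynomial.X 0 * MvPolynomial.X 1 + MvPolynomial.X 2 * MvPolynomial.X 2 +
        MvPolynomial.C b * (MvPolynomial.X 2 * MvPolynomial.X 3) +
        MvPolynomial.C a * (MvPolynomial.X 3 * MvPolynomial.X 3)) 2)
      (Set.range fun t => MvPolynomial.pderiv t (chartPoly (MvPolynomial.X 0 * MvPolynomial.X 1 +
        MvPolynomial.X 2 * MvPolynomial.X 2 + MvPolynomial.C b * (MvPolynomial.X 2 * MvPolynomial.X 3) +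
        MvPolynomial.C a * (MvPolynomial.X 3 * MvPolynomial.X 3)) 2))) = ⊤ := by
  classical
  have hd : residue S b ^ 2 - 4 * residue S a ≠ 0 := by
    have h := (hD.map (residue S)).ne_zero
    rwa [map_sub, map_pow, map_mul, map_ofNat] at h
  set F := chartPoly (MvPolynomial.X 0 * MvPolynomial.X 1 + MvPolynomial.X 2 * MvPolynomial.X 2 +
        MvPolynomial.C b * (MvPolynomial.X 2 * MvPolynomial.X 3) +
        MvPolynomial.C a * (MvPolynomial.X 3 * MvPolynomial.X 3)) 2 with hFdef
  set I := Ideal.span (insert F (Set.range fun t => MvPolynomial.pderiv t F)) with hI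
  have hF : F ∈ I := Ideal.subset_span (Set.mem_insert _ _)
  have hdF : ∀ t, MvPolynomial.pderiv t F ∈ I := fun t =>
    Ideal.subset_span (Set.mem_insert_of_mem _ (Set.mem_range_self t))
  have hFexp : F = MvPolynomial.X ⟨0, by decide⟩ * MvPolynomial.X ⟨1, by decide⟩ + 1 +
      MvPolynomial.C (residue S b) * MvPolynomial.X ⟨3, by decide⟩ +
      MvPolynomial.C (residue S a) * (MvPolynomial.X ⟨3, by decide⟩ * MvPolynomial.X ⟨3, by decide⟩) := by
    rw [hFdef, chartPoly_discForm, killVar_self, killVar_of_ne 2 0 (by decide), killVar_of_ne 2 1 (by decide),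
      killVar_of_ne 2 3 (by decide)]
    ring
  have h3 : MvPolynomial.pderiv (⟨3, by decide⟩ : {j : Fin 4 // j ≠ 2}) F =
      MvPolynomial.C (residue S b) + 2 * MvPolynomial.C (residue S a) * MvPolynomial.X ⟨3, by decide⟩ := by
    rw [hFexp]
    simp [MvPolynomial.pderiv_X]
    ring
  have h0 : MvPolynomial.pderiv (⟨0, by decide⟩ : {j : Fin 4 // j ≠ 2}) F = MvPolynomial.X ⟨1, by decide⟩ := by
    rw [hFexp]
    simp [MvPolynomial.pderiv_X]
  have hmem : MvPolynomial.pderiv (⟨3, by decide⟩ : {j : Fin 4 // j ≠ 2}) F * MvPolynomial.pderiv ⟨3, by decide⟩ F +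
      4 * MvPolynomial.C (residue S a) * MvPolynomial.X ⟨0, by decide⟩ * MvPolynomial.pderiv ⟨0, by decide⟩ F -
      4 * MvPolynomial.C (residue S a) * F ∈ I :=
    I.sub_mem (I.add_mem (I.mul_mem_left _ (hdF _)) (I.mul_mem_left _ (hdF _))) (I.mul_mem_left _ hF)
  refine ideal_eq_top_of_mem_of_eq_C hmem ?_ hd
  rw [h3, h0, hFexp, map_sub, map_pow, map_mul, map_ofNat]
  ring

/-- Chart `T₃ = 1`: `(∂₂F₃)² + 4·T₀·∂₀F₃ − 4·F₃ = b̄² − 4ā`. [cite: Matsumura1987, Thm. 30.3] -/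
theorem discForm_smooth_three (hD : IsUnit (b ^ 2 - 4 * a)) :
    Ideal.span (insert (chartPoly (MvPolynomial.X 0 * MvPolynomial.X 1 + MvPolynomial.X 2 * MvPolynomial.X 2 +
        MvPolynomial.C b * (MvPolynomial.X 2 * MvPolynomial.X 3) +
        MvPolynomial.C a * (MvPolynomial.X 3 * MvPolynomial.X 3)) 3)
      (Set.range fun t => MvPolynomial.pderiv t (chartPoly (MvPolynomial.X 0 * MvPolynomial.X 1 +
        MvPolynomial.X 2 * MvPolynomial.X 2 + MvPolynomial.C b * (MvPolynomial.X 2 * MvPolynomial.X 3) +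
        MvPolynomial.C a * (MvPolynomial.X 3 * MvPolynomial.X 3)) 3))) = ⊤ := by
  classical
  have hd : residue S b ^ 2 - 4 * residue S a ≠ 0 := by
    have h := (hD.map (residue S)).ne_zero
    rwa [map_sub, map_pow, map_mul, map_ofNat] at h
  set F := chartPoly (MvPolynomial.X 0 * MvPolynomial.X 1 + MvPolynomial.X 2 * MvPolynomial.X 2 +
        MvPolynomial.C b * (MvPolynomial.X 2 * MvPolynomial.X 3) +
        MvPolynomial.C a * (MvPolynomial.X 3 * MvPolynomial.X 3)) 3 with hFdef
  set I := Ideal.span (insert F (Set.range fun t => MvPolynomial.pderiv t F)) with hI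
  have hF : F ∈ I := Ideal.subset_span (Set.mem_insert _ _)
  have hdF : ∀ t, MvPolynomial.pderiv t F ∈ I := fun t =>
    Ideal.subset_span (Set.mem_insert_of_mem _ (Set.mem_range_self t))
  have hFexp : F = MvPolynomial.X ⟨0, by decide⟩ * MvPolynomial.X ⟨1, by decide⟩ +
      MvPolynomial.X ⟨2, by decide⟩ * MvPolynomial.X ⟨2, by decide⟩ +
      MvPolynomial.C (residue S b) * MvPolynomial.X ⟨2, by decide⟩ + MvPolynomial.C (residue S a) := by
    rw [hFdef, chartPoly_discForm, killVar_self, killVar_of_ne 3 0 (by decide), killVar_of_ne 3 1 (by decide),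
      killVar_of_ne 3 2 (by decide)]
    ring
  have h2 : MvPolynomial.pderiv (⟨2, by decide⟩ : {j : Fin 4 // j ≠ 3}) F =
      2 * MvPolynomial.X ⟨2, by decide⟩ + MvPolynomial.C (residue S b) := by
    rw [hFexp]
    simp [MvPolynomial.pderiv_X]
    ring
  have h0 : MvPolynomial.pderiv (⟨0, by decide⟩ : {j : Fin 4 // j ≠ 3}) F = MvPolynomial.X ⟨1, by decide⟩ := by
    rw [hFexp]
    simp [MvPolynomial.pderiv_X]
  have hmem : MvPolynomial.pderiv (⟨2, by decide⟩ : {j : Fin 4 // j ≠ 3}) F * MvPolynomial.pderiv ⟨2, by decide⟩ F +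
      4 * MvPolynomial.X ⟨0, by decide⟩ * MvPolynomial.pderiv ⟨0, by decide⟩ F - 4 * F ∈ I :=
    I.sub_mem (I.add_mem (I.mul_mem_left _ (hdF _)) (I.mul_mem_left _ (hdF _))) (I.mul_mem_left _ hF)
  refine ideal_eq_top_of_mem_of_eq_C hmem ?_ hd
  rw [h2, h0, hFexp, map_sub, map_pow, map_mul, map_ofNat]
  ring

/-- **The reduced quadric of `T₀T₁ + T₂² + b T₂T₃ + a T₃²` is smooth on every chart** when `b² − 4a` is a unit.
[cite: Matsumura1987, Thm. 30.3] -/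
theorem discForm_smooth (hD : IsUnit (b ^ 2 - 4 * a)) (i : Fin 4) :
    Ideal.span (insert (chartPoly (MvPolynomial.X 0 * MvPolynomial.X 1 + MvPolynomial.X 2 * MvPolynomial.X 2 +
        MvPolynomial.C b * (MvPolynomial.X 2 * MvPolynomial.X 3) +
        MvPolynomial.C a * (MvPolynomial.X 3 * MvPolynomial.X 3)) i)
      (Set.range fun t => MvPolynomial.pderiv t (chartPoly (MvPolynomial.X 0 * MvPolynomial.X 1 +
        MvPolynomial.X 2 * MvPolynomial.X 2 + MvPolynomial.C b * (MvPolynomial.X 2 * MvPolynomial.X 3) +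
        MvPolynomial.C a * (MvPolynomial.X 3 * MvPolynomial.X 3)) i))) = ⊤ := by
  fin_cases i
  · exact discForm_smooth_zero a b
  · exact discForm_smooth_one a b
  · exact discForm_smooth_two a b hD
  · exact discForm_smooth_three a b hD

end DiscForm

/-! ## The rung «r-quadric-disc-ℓ» -/

section DiscRung

variable {S : Type u} [CommRing S] [IsRegularLocalRing S]
  (x : Fin 4 → S) (hx : Ideal.span (Set.range x) = maximalIdeal S) (hdim : ringKrullDim S = (4 : ℕ))
  (a b : S) (hD : IsUnit (b ^ 2 - 4 * a)) (ℓ : ℕ)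

include hx hdim hD in
/-- **RUNG «r-quadric-disc-ℓ», UNCONDITIONAL PACKAGE**: for `S` regular local of dimension `4`, `x` spanning `𝔪`, `a, b ∈ S`
with `b² − 4a` a unit, `q = x₀x₁ + x₂² + b x₂x₃ + a x₃²` and EVERY `ℓ`: (1) `(q) + 𝔪^{ℓ+2} ∈ 𝒞`; (2) the blow-up-form core
conclusion for every `T = Bl_I Spec S`, `I = (q) + 𝔪^{ℓ+2}`.  Split (`T² + b̄T + ā` reducible) and NON-SPLIT nondegenerate
quadrics at once; every characteristic, every residue field, no completeness, fact-free (`smoothQuadricRung_of_ringKrullDim` +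
`discForm_smooth`). [cite: Kollar2007, 3.61 and (3.111) Step 3] [cite: StacksProject, Tag 080A] -/
theorem discQuadricRung_of_ringKrullDim :
    (∃ (P : Ideal S) (m : ℕ), IsLocalRing.maximalIdeal S ^ m ≤ P ∧
      ∃ (B' : Scheme.{u}) (β : B' ⟶ Spec (.of S)),
        IsBlowup β (affineBlowup.idealSheaf
          ((Ideal.span {x 0 * x 1 + x 2 ^ 2 + b * x 2 * x 3 + a * x 3 ^ 2} ⊔ maximalIdeal S ^ (ℓ + 2)) * P)) ∧
        Scheme.IsRegular B') ∧
    (∀ (T : Scheme.{u}) (f : T ⟶ Spec (.of S)),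
      IsBlowup f (affineBlowup.idealSheaf
        (Ideal.span {x 0 * x 1 + x 2 ^ 2 + b * x 2 * x 3 + a * x 3 ^ 2} ⊔ maximalIdeal S ^ (ℓ + 2))) →
      ∃ (J : T.IdealSheafData) (T' : Scheme.{u}) (π : T' ⟶ T), J ≠ ⊥ ∧
        (∀ t : T, t ∈ J.support → f.base t = IsLocalRing.closedPoint S) ∧
        IsBlowup π J ∧ Scheme.IsRegular T') := by
  rw [← eval_discForm a b x]
  exact smoothQuadricRung_of_ringKrullDim x hx hdim _ (isHomogeneous_discForm a b) (discForm_smooth a b hD) ℓ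

end DiscRung

/-- **The registered core's binder shape on the member `(x₀x₁ + x₂² + b x₂x₃ + a x₃²) + 𝔪^{ℓ+2}`**, `b² − 4a` a unit
(hypotheses of `stub_atomDimFourBlowup`; characteristic, completeness, perfectness and the off-fibre hypothesis unused).
[cite: Kollar2007, 3.61] -/
theorem atomDimFourBlowupAt_discQuadric (p : ℕ) (_hp : p.Prime) (S : Type) [CommRing S]
    [IsRegularLocalRing S] [CharP S p] [IsAdicComplete (IsLocalRing.maximalIdeal S) S]
    [PerfectField (IsLocalRing.ResidueField S)] (hS : ringKrullDim S = (4 : ℕ))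
    (x : Fin 4 → S) (hx : Ideal.span (Set.range x) = IsLocalRing.maximalIdeal S)
    (a b : S) (hD : IsUnit (b ^ 2 - 4 * a)) (ℓ : ℕ)
    (T : Scheme.{0}) (f : T ⟶ Spec (.of S))
    (hf : IsBlowup f (affineBlowup.idealSheaf
      (Ideal.span {x 0 * x 1 + x 2 ^ 2 + b * x 2 * x 3 + a * x 3 ^ 2} ⊔ IsLocalRing.maximalIdeal S ^ (ℓ + 2))))
    (_hoff : ∀ t : T, f.base t ≠ IsLocalRing.closedPoint S → IsRegularLocalRing (T.presheaf.stalk t)) :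
    ∃ (J : T.IdealSheafData) (T' : Scheme.{0}) (π : T' ⟶ T), J ≠ ⊥ ∧
      (∀ t : T, t ∈ J.support → f.base t = IsLocalRing.closedPoint S) ∧
      IsBlowup π J ∧ Scheme.IsRegular T' :=
  (discQuadricRung_of_ringKrullDim x hx hS a b hD ℓ).2 T f hf

end ConeDepth

end Summit.ResolutionOfSingularities.ResolutionOfSingularities.Theorems

end
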